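import Summits.Ventures.PercRepro.LemmaBPlusSub
import Summits.Ventures.PercRepro.LemmaBPlusK5

/-!
# `C005UpTo 5` and `C011UpTo 5`, fully kernel-checked

Every simple graph on five vertices is a spanning subgraph of `K₅`, and every injective 4-marking is,
up to a permutation of the vertices, the marking `0, 1, 2, 3`.  So the kernel facts on the faces of
`K₅` (`facesCheckS_k5`, LemmaBPlusK5.lean) give `0 ≤ CS(graphOf A, m)` for every adjacency matrix
`A : Fin 5 → Fin 5 → Bool` and every injective `m`:

* `exists_perm_of_injective`: a permutation `π` of `Fin 5` with `π ∘ m = ![0, 1, 2, 3]`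
  (Mathlib's `Equiv.extendSubtype`); typer-2's `cubeSumC011_mapVertices` moves the class sum along it,
  `cubeSumC011_eq_graphOf_adjOf` normalises the relabelled graph to the graph of its adjacency matrix;
* `pairIdx5` / `ιOf` embed the edges of `graphOf B` into `K₅` (`subOf_graphOf`), and
  `cubeSumC011_nonneg_of_facesBPlus_sub` (LemmaBPlusSub.lean) reads the class sum off a face of `K₅`.

Hence **`census5`**, **`lemmaBPlusSimpleInj5 : LemmaBPlusSimpleInjUpTo 5`**, **`c005UpTo5 : C005UpTo 5`**,
**`c011UpTo5 : C011UpTo 5`**: C-005 and C-011 hold on EVERY multigraph with at most five vertices, for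
every `p ∈ [0,1]^E` and every marking — the 54 kernel slices of `K₅` plus the reduction chain, no
computation outside the Lean kernel.
-/

namespace PercRepro

namespace MultiGraph

/-- The index of the pair `(i, j)`, `i < j`, in the edge order of `k5` (`01, 02, 03, 04, 12, 13, 14, 23, 24, 34`);
`0` elsewhere. -/
def pairIdx5 : Fin 5 → Fin 5 → Fin 10 :=
  ![![0, 0, 1, 2, 3], ![0, 0, 4, 5, 6], ![0, 0, 0, 7, 8], ![0, 0, 0, 0, 9], ![0, 0, 0, 0, 0]]

/-- The endpoints of `pairIdx5 i j` in `k5` are `i`, `j` (for `i < j`). -/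
theorem k5_pairIdx5 : ∀ i j : Fin 5, i < j →
    Examples.k5.fst (pairIdx5 i j) = i ∧ Examples.k5.snd (pairIdx5 i j) = j := by
  decide

/-- `pairIdx5` is injective on increasing pairs. -/
theorem pairIdx5_injective : ∀ i j i' j' : Fin 5, i < j → i' < j' →
    pairIdx5 i j = pairIdx5 i' j' → i = i' ∧ j = j' := by
  decide

/-- The edges of `graphOf B` as edges of `K₅`. -/
def ιOf (B : Fin 5 → Fin 5 → Bool) : EdgesOf B → Fin 10 := fun e => pairIdx5 e.1.1 e.1.2

/-- `graphOf B` sits inside `K₅` along `ιOf B`. -/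
theorem subOf_graphOf (B : Fin 5 → Fin 5 → Bool) : (graphOf B).SubOf Examples.k5 (ιOf B) := by
  refine ⟨?_, fun e => Or.inl (k5_pairIdx5 e.1.1 e.1.2 e.2.1)⟩
  intro e e' h
  obtain ⟨h1, h2⟩ := pairIdx5_injective e.1.1 e.1.2 e'.1.1 e'.1.2 e.2.1 e'.2.1 h
  exact Subtype.ext (Prod.ext h1 h2)

/-- The marking `0, 1, 2, 3` of `Fin 5`. -/
def m₀ : Fin 4 → Fin 5 := ![0, 1, 2, 3]

/-- `m₀` is injective. -/
theorem m₀_injective : Function.Injective m₀ := by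
  intro i j h
  revert i j
  decide

open Classical in
/-- **Relabelling**: an injective marking is `m₀` after a permutation of the vertices. -/
theorem exists_perm_of_injective (m : Fin 4 → Fin 5) (hm : Function.Injective m) :
    ∃ π : Equiv.Perm (Fin 5), ∀ i, π (m i) = m₀ i := by
  let e : {x : Fin 5 // x ∈ Set.range m} ≃ {x : Fin 5 // x ∈ Set.range m₀} :=
    (Equiv.ofInjective m hm).symm.trans (Equiv.ofInjective m₀ m₀_injective)
  refine ⟨e.extendSubtype, fun i => ?_⟩
  rw [e.extendSubtype_apply_of_mem (m i) ⟨i, rfl⟩]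
  show ((Equiv.ofInjective m₀ m₀_injective) ((Equiv.ofInjective m hm).symm ⟨m i, ⟨i, rfl⟩⟩) : Fin 5) = m₀ i
  rw [Equiv.ofInjective_symm_apply hm i]
  rfl

end MultiGraph

open MultiGraph Examples

/-- `graphOf A` is a simple graph (pairs `i < j`, each at most once). -/
theorem isSimple_graphOf5 (A : Fin 5 → Fin 5 → Bool) : (graphOf A).IsSimple := by
  constructor
  · intro e h
    exact absurd h (ne_of_lt e.2.1)
  · intro e e' h
    rcases h with ⟨h1, h2⟩ | ⟨h1, h2⟩
    · exact Subtype.ext (Prod.ext h1 h2)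
    · exfalso
      have := e.2.1
      have := e'.2.1
      simp only [graphOf] at h1 h2
      omega

/-- **The adjacency-matrix census on five vertices**: `0 ≤ CS(graphOf A, m)` for every matrix `A` and
every injective marking `m` — from the faces of `K₅`. -/
theorem census5 (A : Fin 5 → Fin 5 → Bool) (m : Fin 4 → Fin 5) (hm : Function.Injective m) :
    0 ≤ (graphOf A).cubeSumC011 m := by
  obtain ⟨π, hπ⟩ := exists_perm_of_injective m hm
  rw [← (graphOf A).cubeSumC011_mapVertices π.injective m]
  have hcomp : (⇑π ∘ m) = m₀ := funext hπ
  rw [hcomp, ((graphOf A).mapVertices ⇑π).cubeSumC011_eq_graphOf_adjOf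
    ((graphOf A).isSimple_mapVertices π.injective (isSimple_graphOf5 A))]
  exact (graphOf _).cubeSumC011_nonneg_of_facesBPlus_sub k5 (subOf_graphOf _) m₀
    (k5.facesBPlus_of_facesCheckS _ facesCheckS_k5)

/-- **Lemma B⁺ on every simple graph with ≤ 5 vertices, every injective marking** — kernel-checked. -/
theorem lemmaBPlusSimpleInj5 : LemmaBPlusSimpleInjUpTo 5 :=
  LemmaBPlusSimpleInjUpTo_of_graphOf 5 census5

/-- **C-005 on every multigraph with ≤ 5 vertices at every `p`** — kernel-checked end to end. -/
theorem c005UpTo5 : C005UpTo 5 := C005UpTo_of_graphOf 5 census5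

/-- **C-011 on every multigraph with ≤ 5 vertices at every `p`** — kernel-checked end to end. -/
theorem c011UpTo5 : C011UpTo 5 := C011UpTo_of_graphOf 5 census5

end PercRepro
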